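import Summits.RiemannHypothesis.RiemannHypothesis.Statement
import Literature.NumberTheory.LFunctions.TuranLiouvilleCriterionSqrt
import HarnessLib

/-!
# One-sided boundedness of `L_{1/2}(x) = ∑_{n ≤ x} λ(n)/√n` implies RH (solo-informed T57)

`L_{1/2}(x) = ∑_{1 ≤ n ≤ x} λ(n)/√n` (`liouvilleSqrtSum`) is the `α = 1/2` member of
Mossinghoff–Trudgian's family `L_α(x) = ∑_{n ≤ x} λ(n) n^{-α}`. Its transform
`∫_1^∞ L_{1/2}(x) x^{-u-1} dx = ζ(2u+1)/(u ζ(u+1/2))` (`Re u > 1/2`) is holomorphic near the real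
half-line `u > 0` (no real zeros of `ζ` right of `1/2`), so Landau's lemma (MV Lemma 15.1, tree
`Landau.integrableOn_of_differentiableOn_union_convex`) and the identity theorem give
`riemannHypothesis_of_liouvilleSqrtSum_onesided` (`ε ≠ 0`, `ε L_{1/2}(x) + c ≥ 0` for `x > X₁`
⟹ RH), `riemannHypothesis_of_liouvilleSqrtSum_le` (`L_{1/2}` bounded above on a half-line ⟹ RH)
and `riemannHypothesis_of_mossinghoffTrudgianHalf`: the conjecture `L_{1/2}(x) ≤ 0` for all
`x ≥ 17` (MT2012 Problem 4.3, verified there for `17 ≤ x ≤ 10¹²`) implies RH.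

This is the `α = 1/2` row missing from the tree's Landau dictionary (`Polya1919_criterion_holds`,
`Turan1948.riemannHypothesis_of_nonneg`; `TuranLiouvilleCriterionSqrt`: "Not formalised: … its
`L_{1/2}` variant"), and the one member of the Pólya–Turán family that is unrefuted and believed:
under RH the sum drifts like `(log x)/(2ζ(1/2)) ≈ -0.342 log x → -∞` (MT2012 (2.3)), so eventual
negativity is compatible with the Ingham mechanism that kills Pólya (`α = 0`) and Turán (`α = 1`);
Humphries 2013 Thm 1.6: under RH and `J₋₁(T) ≪ T` the exceptional set has logarithmic density
`0`. NOT proved here (open in print): the converse "RH ⟹ `L_{1/2} ≤ 0` eventually" (MT2012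
Problem 4.4) and MT2012's simplicity conclusion.

References: Mossinghoff–Trudgian, J. Aust. Math. Soc. 93 (2012) 157–171, Thm 2.4, (2.3),
Problems 4.3–4.4 (key `MossinghoffTrudgian2012`); Humphries, arXiv:1108.1524, Thms 1.5–1.6;
Montgomery–Vaughan, *Multiplicative Number Theory I* (2007), §15.1 Lemma 15.1
(key `MontgomeryVaughan2007`).
-/

noncomputable section

open Complex Filter Set MeasureTheory ArithmeticFunction
open scoped Topology

namespace Summit.RiemannHypothesis.RiemannHypothesis.Theorems

open Literature.NumberTheory.LFunctions Literature.NumberTheory.LFunctions.TuranLiouville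

/-- `L_{1/2}(x) = ∑_{1 ≤ n ≤ x} λ(n)/√n`, the `α = 1/2` weighted Liouville sum (in the style of the
tree's `liouvilleSum`, `liouvilleHarmonicSum`). [cite: MossinghoffTrudgian2012, §1 (1.4)] -/
def liouvilleSqrtSum (x : ℝ) : ℝ :=
  ∑ n ∈ Finset.Ioc 0 ⌊x⌋₊, (ArithmeticFunction.liouville n : ℝ) / Real.sqrt n

namespace LiouvilleHalf

/-- `L_{1/2}` is measurable (a step function of `⌊x⌋`). [folklore] -/
theorem measurable_liouvilleSqrtSum : Measurable liouvilleSqrtSum :=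
  (measurable_from_nat (f := fun m : ℕ ↦
    ∑ n ∈ Finset.Ioc 0 m, (liouville n : ℝ) / Real.sqrt n)).comp Nat.measurable_floor

/-- The trivial bound `|L_{1/2}(x)| ≤ x` for `x ≥ 0` (each `|λ(n)/√n| ≤ 1`). [folklore] -/
theorem abs_liouvilleSqrtSum_le {x : ℝ} (hx : 0 ≤ x) : |liouvilleSqrtSum x| ≤ x := by
  rw [liouvilleSqrtSum]
  refine (Finset.abs_sum_le_sum_abs _ _).trans ?_
  calc ∑ n ∈ Finset.Ioc 0 ⌊x⌋₊, |(liouville n : ℝ) / Real.sqrt n|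
      ≤ ∑ n ∈ Finset.Ioc 0 ⌊x⌋₊, (1 : ℝ) := Finset.sum_le_sum fun n hn ↦ by
        have hn1 : (1 : ℝ) ≤ n := by exact_mod_cast (Finset.mem_Ioc.1 hn).1
        have hs1 : (1 : ℝ) ≤ Real.sqrt n := Real.one_le_sqrt.2 hn1
        rw [abs_div, abs_of_nonneg (Real.sqrt_nonneg _)]
        calc |(liouville n : ℝ)| / Real.sqrt n ≤ 1 / Real.sqrt n :=
              div_le_div_of_nonneg_right (LiouvilleSum.abs_liouville_le_one n) (by linarith)
          _ ≤ 1 := (div_le_one (by linarith)).2 hs1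
    _ = ⌊x⌋₊ := by simp
    _ ≤ x := Nat.floor_le hx

/-- For measurable `f` with the linear a-priori bound `|f x| ≤ x` (`x ≥ 0`; shared by every
`L_α`, `α ≥ 0`), `f(x) x^{-(s+1)}` is integrable on `(1, ∞)` for `Re s > 1`. [folklore] -/
theorem integrableOn_ofReal_mul_cpow_of_abs_le {f : ℝ → ℝ} (hf : Measurable f)
    (hb : ∀ x : ℝ, 0 ≤ x → |f x| ≤ x) {s : ℂ} (hs : 1 < s.re) :
    IntegrableOn (fun x : ℝ ↦ (f x : ℂ) * (x : ℂ) ^ (-(s + 1))) (Ioi 1) := by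
  have hint : IntegrableOn (fun x : ℝ ↦ x ^ (-s.re)) (Ioi 1) :=
    integrableOn_Ioi_rpow_of_lt (by linarith) zero_lt_one
  refine Integrable.mono' hint ?_ ?_
  · exact ((measurable_ofReal.comp hf).mul (measurable_ofReal.pow_const _)).aestronglyMeasurable
  · rw [ae_restrict_iff' measurableSet_Ioi]
    refine Eventually.of_forall fun x (hx : 1 < x) ↦ ?_
    have hx0 : 0 < x := zero_lt_one.trans hx
    rw [norm_mul, norm_real, Real.norm_eq_abs, norm_cpow_eq_rpow_re_of_pos hx0, neg_re, add_re,
      one_re]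
    calc |f x| * x ^ (-(s.re + 1)) ≤ x * x ^ (-(s.re + 1)) := by gcongr; exact hb x hx0.le
      _ = x ^ (-s.re) := by rw [mul_comm, ← Real.rpow_add_one hx0.ne']; congr 1; ring

/-- `√k = k^{1/2}` as complex numbers. [folklore] -/
theorem ofReal_sqrt_natCast (k : ℕ) : ((Real.sqrt k : ℝ) : ℂ) = (k : ℂ) ^ (1 / 2 : ℂ) := by
  rw [Real.sqrt_eq_rpow, ofReal_cpow (Nat.cast_nonneg k)]
  push_cast
  try rfl

/-- The coefficients `λ(k)/√k` have absolute value at most `1`. [folklore] -/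
theorem norm_coeff_le_one (k : ℕ) : ‖(liouville k : ℂ) / (Real.sqrt k : ℂ)‖ ≤ 1 := by
  rcases eq_or_ne k 0 with rfl | hk
  · simp
  · have hk1 : (1 : ℝ) ≤ k := by exact_mod_cast Nat.one_le_iff_ne_zero.2 hk
    have hs1 : (1 : ℝ) ≤ Real.sqrt k := Real.one_le_sqrt.2 hk1
    rw [norm_div, norm_real, Real.norm_eq_abs, abs_of_nonneg (Real.sqrt_nonneg _)]
    exact (div_le_one (by linarith)).2 ((norm_liouville_le_one k).trans hs1)

/-- The partial sums `∑_{k ≤ n} λ(k)/√k` written with `L_{1/2}`. [folklore] -/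
theorem sum_Icc_coeff (n : ℕ) :
    ∑ k ∈ Finset.Icc 1 n, (liouville k : ℂ) / (Real.sqrt k : ℂ) =
      ((liouvilleSqrtSum n : ℝ) : ℂ) := by
  rw [liouvilleSqrtSum, Nat.floor_natCast]
  have hI : Finset.Icc 1 n = Finset.Ioc 0 n := by
    ext k
    simp only [Finset.mem_Icc, Finset.mem_Ioc]
    omega
  rw [hI]
  push_cast
  try rfl

/-- `∑ (λ(k)/√k) k^{-u} = ∑ λ(k) k^{-(u+1/2)}` termwise. [folklore] -/
theorem term_coeff (u : ℂ) :
    LSeries.term (fun k ↦ (liouville k : ℂ) / (Real.sqrt k : ℂ)) u =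
      LSeries.term (fun k ↦ (liouville k : ℂ)) (u + 1 / 2) := by
  funext k
  rcases eq_or_ne k 0 with rfl | hk
  · simp
  · have hk' : (k : ℂ) ≠ 0 := Nat.cast_ne_zero.2 hk
    rw [LSeries.term_of_ne_zero hk, LSeries.term_of_ne_zero hk, ofReal_sqrt_natCast,
      cpow_add _ _ hk', div_div, mul_comm]

/-- **Partial summation** (Mathlib `LSeries_eq_mul_integral`): for `Re u > 1`,
`u · ∫_1^∞ L_{1/2}(x) x^{-(u+1)} dx = ∑ λ(k) k^{-(u+1/2)}`.
[cite: MontgomeryVaughan2007, §1.2 Thm. 1.3] -/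
theorem mul_mellinIoi_liouvilleSqrtSum {u : ℂ} (hu : 1 < u.re) :
    u * Landau.mellinIoi liouvilleSqrtSum u =
      LSeries (fun k ↦ (liouville k : ℂ)) (u + 1 / 2) := by
  set f : ℕ → ℂ := fun k ↦ (liouville k : ℂ) / (Real.sqrt k : ℂ) with hf
  have hS : LSeriesSummable f u :=
    LSeriesSummable_of_bounded_of_one_lt_re (m := 1) (fun k _ ↦ norm_coeff_le_one k) hu
  have hO : (fun n ↦ ∑ k ∈ Finset.Icc 1 n, f k) =O[atTop] fun n ↦ (n : ℝ) ^ (1 : ℝ) := by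
    refine Asymptotics.IsBigO.of_bound 1 (Eventually.of_forall fun n ↦ ?_)
    rw [Real.norm_eq_abs, abs_of_nonneg (Real.rpow_nonneg n.cast_nonneg _), Real.rpow_one, one_mul]
    refine (norm_sum_le _ _).trans ?_
    calc ∑ k ∈ Finset.Icc 1 n, ‖f k‖ ≤ ∑ k ∈ Finset.Icc 1 n, (1 : ℝ) :=
          Finset.sum_le_sum fun k _ ↦ norm_coeff_le_one k
      _ = n := by simp
  have hL := LSeries_eq_mul_integral f zero_le_one (by simpa using hu) hS hO
  have hint : ∫ t in Ioi (1 : ℝ), (∑ k ∈ Finset.Icc 1 ⌊t⌋₊, f k) * (t : ℂ) ^ (-(u + 1)) =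
      Landau.mellinIoi liouvilleSqrtSum u := by
    rw [Landau.mellinIoi]
    refine setIntegral_congr_fun measurableSet_Ioi fun t _ ↦ ?_
    simp only [hf]
    rw [sum_Icc_coeff ⌊t⌋₊]
    congr 2
    rw [liouvilleSqrtSum, liouvilleSqrtSum, Nat.floor_natCast]
  rw [← hint, ← hL, LSeries, LSeries, hf, term_coeff]

/-- **`∫_1^∞ L_{1/2}(x) x^{-(u+1)} dx · (u ζ₁(u+1/2)) = (u - 1/2) ζ(2u+1)`** for `Re u > 1`
(`ζ₁(s) = (s−1)ζ(s)`; partial summation and `(∑ λ(n) n^{-s}) ζ(s) = ζ(2s)` at `s = u + 1/2`).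
[cite: MossinghoffTrudgian2012, (2.4)–(2.5)] -/
theorem mellinIoi_liouvilleSqrtSum_mul {u : ℂ} (hu : 1 < u.re) :
    Landau.mellinIoi liouvilleSqrtSum u * (u * riemannZeta₁ (u + 1 / 2)) =
      (u - 1 / 2) * riemannZeta (2 * u + 1) := by
  have hu1 : u + 1 / 2 ≠ 1 := by
    intro h; have := congrArg re h; simp at this; linarith
  have hre : 1 < (u + 1 / 2).re := by simp; linarith
  rw [riemannZeta₁_eq_mul hu1, show u + 1 / 2 - 1 = u - 1 / 2 by ring]
  calc Landau.mellinIoi liouvilleSqrtSum u * (u * ((u - 1 / 2) * riemannZeta (u + 1 / 2)))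
      = (u - 1 / 2) * (u * Landau.mellinIoi liouvilleSqrtSum u * riemannZeta (u + 1 / 2)) := by ring
    _ = (u - 1 / 2) * riemannZeta (2 * (u + 1 / 2)) := by
        rw [mul_mellinIoi_liouvilleSqrtSum hu, LSeries_liouville_mul_riemannZeta hre]
    _ = (u - 1 / 2) * riemannZeta (2 * u + 1) := by congr 2; ring

/-- `∫_1^∞ x^{-(u+1)} dx = 1/u` for `Re u > 0`: the transform of the constant `1`. [folklore] -/
theorem mellinIoi_const_one {u : ℂ} (hu : 0 < u.re) :
    Landau.mellinIoi (fun _ ↦ (1 : ℝ)) u = 1 / u := by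
  have ha : (-(u + 1)).re < -1 := by simp; linarith
  rw [Landau.mellinIoi]
  simp only [ofReal_one, one_mul]
  rw [integral_Ioi_cpow_of_lt ha zero_lt_one, ofReal_one, one_cpow,
    show -(u + 1) + 1 = -u by ring, neg_div_neg_eq]

/-- `1 · x^{-(u+1)}` is integrable on `(1, ∞)` for `Re u > 0`. [folklore] -/
theorem integrableOn_const_one_mul_cpow {u : ℂ} (hu : 0 < u.re) :
    IntegrableOn (fun x : ℝ ↦ (((fun _ ↦ (1 : ℝ)) x : ℝ) : ℂ) * (x : ℂ) ^ (-(u + 1))) (Ioi 1) :=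
  (integrableOn_Ioi_cpow_of_lt (by simp; linarith : (-(u + 1)).re < -1) zero_lt_one).congr_fun
    (fun x _ ↦ by simp only [ofReal_one, one_mul]) measurableSet_Ioi

/-- `g(x) = ε L_{1/2}(x) + c` is measurable. [folklore] -/
theorem measurable_gfun (ε c : ℝ) :
    Measurable (fun x : ℝ ↦ ε * liouvilleSqrtSum x + c) :=
  (measurable_const.mul measurable_liouvilleSqrtSum).add measurable_const

/-- `|g(x)| ≤ (|ε| + |c|) x` for `x ≥ 1`. [folklore] -/
theorem abs_gfun_le {ε c x : ℝ} (hx : 1 ≤ x) :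
    |ε * liouvilleSqrtSum x + c| ≤ (|ε| + |c|) * x := by
  have hx0 : 0 ≤ x := zero_le_one.trans hx
  have h1 : |liouvilleSqrtSum x| ≤ x := abs_liouvilleSqrtSum_le hx0
  calc |ε * liouvilleSqrtSum x + c|
      ≤ |ε * liouvilleSqrtSum x| + |c| := abs_add_le _ _
    _ = |ε| * |liouvilleSqrtSum x| + |c| * 1 := by rw [abs_mul, mul_one]
    _ ≤ |ε| * x + |c| * x := by gcongr
    _ = (|ε| + |c|) * x := by ring

/-- Absolute convergence of the transform of `g` at `σ₁ = 2`: `∫_1^∞ |g(x)| x^{-3} dx < ∞`.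
[folklore] -/
theorem integrableOn_gfun (ε c : ℝ) :
    IntegrableOn (fun x ↦ (ε * liouvilleSqrtSum x + c) * x ^ (-((2 : ℝ) + 1))) (Ioi 1) := by
  have hint : IntegrableOn (fun x : ℝ ↦ (|ε| + |c|) * x ^ (-2 : ℝ)) (Ioi 1) :=
    (integrableOn_Ioi_rpow_of_lt (by norm_num) zero_lt_one).const_mul _
  refine Integrable.mono' hint ?_ ?_
  · exact ((measurable_gfun ε c).mul (measurable_id.pow_const _)).aestronglyMeasurable
  · rw [ae_restrict_iff' measurableSet_Ioi]
    refine Eventually.of_forall fun x (hx : 1 < x) ↦ ?_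
    have hx0 : 0 < x := zero_lt_one.trans hx
    rw [norm_mul, Real.norm_eq_abs, Real.norm_eq_abs, abs_of_pos (Real.rpow_pos_of_pos hx0 _)]
    calc |ε * liouvilleSqrtSum x + c| * x ^ (-((2 : ℝ) + 1))
        ≤ (|ε| + |c|) * x * x ^ (-((2 : ℝ) + 1)) := by
          gcongr; exact abs_gfun_le hx.le
      _ = (|ε| + |c|) * x ^ (-2 : ℝ) := by
          rw [mul_assoc, mul_comm x, show (-((2 : ℝ) + 1)) = (-2 : ℝ) + -1 by norm_num,
            Real.rpow_add hx0, Real.rpow_neg_one, mul_assoc, inv_mul_cancel₀ hx0.ne', mul_one]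

/-- `Φ(u) = ε (u-1/2)ζ(2u+1)/(u ζ₁(u+1/2)) + c/u` is holomorphic where `u ≠ 0`, `ζ₁(u + 1/2) ≠ 0`.
[cite: MossinghoffTrudgian2012, (2.4)–(2.5)] -/
theorem differentiableAt_Phi {ε c : ℝ} {u : ℂ} (hu0 : u ≠ 0) (h1 : riemannZeta₁ (u + 1 / 2) ≠ 0) :
    DifferentiableAt ℂ (fun u : ℂ ↦
      ε * ((u - 1 / 2) * riemannZeta (2 * u + 1) / (u * riemannZeta₁ (u + 1 / 2))) + c / u) u := by
  have h2 : 2 * u + 1 ≠ 1 := by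
    intro h; apply hu0; linear_combination h / 2
  have hζ : DifferentiableAt ℂ (fun u ↦ riemannZeta (2 * u + 1)) u :=
    (differentiableAt_riemannZeta h2).comp u (by fun_prop)
  have hA : DifferentiableAt ℂ (fun u ↦ (u - 1 / 2) * riemannZeta (2 * u + 1)) u :=
    DifferentiableAt.mul (by fun_prop) hζ
  have hden : DifferentiableAt ℂ (fun u ↦ u * riemannZeta₁ (u + 1 / 2)) u := by fun_prop
  have hden0 : u * riemannZeta₁ (u + 1 / 2) ≠ 0 := mul_ne_zero hu0 h1
  exact ((hA.div hden hden0).const_mul _).add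
    ((differentiableAt_const _).div differentiableAt_id hu0)

/-- **The thin rectangle `W₀`**: the box `0 < Re u < 4`, `|Im u| < δ` (`δ` from the tree's
`TuranLiouville.exists_strip_riemannZeta₁_ne_zero`), a convex open neighbourhood of the real segment
`(0, 3]` on which `ζ₁(u + 1/2) ≠ 0`. [folklore] -/
theorem exists_W₀ :
    ∃ W₀ : Set ℂ, IsOpen W₀ ∧ Convex ℝ W₀ ∧ (∀ σ : ℝ, 0 < σ → σ ≤ 3 → (σ : ℂ) ∈ W₀) ∧
      ∀ s ∈ W₀, 0 < s.re ∧ riemannZeta₁ (s + 1 / 2) ≠ 0 := by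
  obtain ⟨δ, hδ, hfree⟩ := exists_strip_riemannZeta₁_ne_zero
  refine ⟨({u : ℂ | 0 < u.re} ∩ {u : ℂ | u.re < 4}) ∩
      ({u : ℂ | u.im < δ} ∩ {u : ℂ | -δ < u.im}),
    ((isOpen_lt continuous_const continuous_re).inter
      (isOpen_lt continuous_re continuous_const)).inter
      ((isOpen_lt continuous_im continuous_const).inter (isOpen_lt continuous_const continuous_im)),
    ((convex_halfSpace_re_gt _).inter (convex_halfSpace_re_lt _)).inter
      ((convex_halfSpace_im_lt _).inter (convex_halfSpace_im_gt _)),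
    fun σ h1 h2 ↦ ?_, ?_⟩
  · refine ⟨⟨?_, ?_⟩, ?_, ?_⟩ <;> simp only [mem_setOf_eq, ofReal_re, ofReal_im] <;> linarith
  · rintro u ⟨⟨(hu1 : 0 < u.re), (hu2 : u.re < 4)⟩, (hu3 : u.im < δ), (hu4 : -δ < u.im)⟩
    have hre : (u + 1 / 2).re = u.re + 1 / 2 := by simp
    have him : (u + 1 / 2).im = u.im := by simp
    refine ⟨hu1, hfree (u + 1 / 2) ?_ ?_ ?_⟩
    · rw [hre]; linarith
    · rw [hre]; linarith
    · rw [him]; exact abs_lt.2 ⟨hu4, hu3⟩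

end LiouvilleHalf

open LiouvilleHalf

/-- **One-sided boundedness of `L_{1/2}` implies RH** (Mossinghoff–Trudgian 2012, Thm 2.4 at
`α = 1/2`, RH part, constant comparison function): if `ε ≠ 0` and `ε L_{1/2}(x) + c ≥ 0` for all
`x > X₁`, then RH. Proof as printed: the transform `Φ(u) = ε ζ(2u+1)/(u ζ(u+1/2)) + c/u` of
`g = ε L_{1/2} + c` is holomorphic near the real half-line `u > 0`; Landau's lemma (tree,
`Landau.integrableOn_of_differentiableOn_union_convex`) makes it holomorphic on `Re u > 0`, and the
identity theorem forbids zeros of `ζ(u + 1/2)` there.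
[cite: MossinghoffTrudgian2012, Theorem 2.4] [cite: MontgomeryVaughan2007, §15.1 Lemma 15.1] -/
theorem riemannHypothesis_of_liouvilleSqrtSum_onesided {ε c X₁ : ℝ} (hε : ε ≠ 0)
    (hpos : ∀ x : ℝ, X₁ < x → 0 ≤ ε * liouvilleSqrtSum x + c) :
    Summit.RiemannHypothesis := by
  set g : ℝ → ℝ := fun x ↦ ε * liouvilleSqrtSum x + c with hg
  set Φ : ℂ → ℂ := fun u ↦
    ε * ((u - 1 / 2) * riemannZeta (2 * u + 1) / (u * riemannZeta₁ (u + 1 / 2))) + c / u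
    with hΦdef
  set X := max X₁ 1 with hX
  have hX1 : 1 ≤ X := le_max_right _ _
  have hposX : ∀ x, X < x → 0 ≤ g x := fun x hx ↦ hpos x (lt_of_le_of_lt (le_max_left _ _) hx)
  obtain ⟨W₀, hW₀o, hW₀c, hW₀r, hW₀ζ⟩ := exists_W₀
  have hne0 : ∀ u : ℂ, 0 < u.re → u ≠ 0 := by rintro u hu rfl; simp at hu
  have hζ₁ne : ∀ u : ℂ, 2 < u.re → riemannZeta₁ (u + 1 / 2) ≠ 0 := by
    intro u hu
    have hu1 : u + 1 / 2 ≠ 1 := by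
      intro h; have := congrArg re h; simp at this; linarith
    rw [Ne, riemannZeta₁_eq_zero_iff hu1]
    exact riemannZeta_ne_zero_of_one_lt_re (by simp; linarith)
  have hΦ : DifferentiableOn ℂ Φ ({s : ℂ | 2 < s.re} ∪ W₀) := by
    rintro s (hs | hs)
    · have hs' : 2 < s.re := hs
      exact (differentiableAt_Phi (hne0 s (by linarith)) (hζ₁ne s hs')).differentiableWithinAt
    · exact (differentiableAt_Phi (hne0 s (hW₀ζ s hs).1) (hW₀ζ s hs).2).differentiableWithinAt
  have hagree : EqOn Φ (Landau.mellinIoi g) {s : ℂ | 2 < s.re} := by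
    intro s hs
    have hs' : 2 < s.re := hs
    have hs0 : s ≠ 0 := hne0 s (by linarith)
    have hT := integrableOn_ofReal_mul_cpow_of_abs_le measurable_liouvilleSqrtSum
      (fun _ ↦ abs_liouvilleSqrtSum_le) (show 1 < s.re by linarith)
    have hR := integrableOn_const_one_mul_cpow (show 0 < s.re by linarith)
    have hsplit : Landau.mellinIoi g s =
        ε * Landau.mellinIoi liouvilleSqrtSum s +
          c * Landau.mellinIoi (fun _ ↦ (1 : ℝ)) s := by
      simp only [Landau.mellinIoi, hg]
      rw [← integral_const_mul, ← integral_const_mul,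
        ← integral_add (hT.const_mul _) (hR.const_mul _)]
      refine setIntegral_congr_fun measurableSet_Ioi fun x _ ↦ ?_
      push_cast
      ring
    have hden : s * riemannZeta₁ (s + 1 / 2) ≠ 0 := mul_ne_zero hs0 (hζ₁ne s hs')
    have hm : Landau.mellinIoi liouvilleSqrtSum s =
        (s - 1 / 2) * riemannZeta (2 * s + 1) / (s * riemannZeta₁ (s + 1 / 2)) := by
      rw [← mellinIoi_liouvilleSqrtSum_mul (by linarith : 1 < s.re), mul_div_cancel_right₀ _ hden]
    rw [hsplit, mellinIoi_const_one (by linarith), hm, hΦdef]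
    beta_reduce
    ring
  -- Landau's lemma: the integral converges absolutely for every `σ > 0`
  have hconv : ∀ σ : ℝ, 0 < σ → IntegrableOn (fun x ↦ g x * x ^ (-(σ + 1))) (Ioi 1) := fun σ hσ ↦
    Landau.integrableOn_of_differentiableOn_union_convex (measurable_gfun ε c)
      (integrableOn_gfun ε c) hX1 hposX (by norm_num : (0 : ℝ) < 2) hW₀o hW₀c
      (fun σ h1 h2 ↦ hW₀r σ h1 (by linarith)) hΦ hagree hσ
  have hF : DifferentiableOn ℂ (Landau.mellinIoi g) {s : ℂ | 0 < s.re} :=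
    Landau.differentiableOn_mellinIoi_of_forall (measurable_gfun ε c) hconv
  -- identity theorem on the half-plane `Re u > 0`, in pole-free form
  set FL : ℂ → ℂ := fun s ↦ Landau.mellinIoi g s * (s * riemannZeta₁ (s + 1 / 2)) with hL
  set FR : ℂ → ℂ := fun s ↦
    ε * ((s - 1 / 2) * riemannZeta (2 * s + 1)) + c * riemannZeta₁ (s + 1 / 2) with hR
  have hV : IsOpen {s : ℂ | 0 < s.re} := Landau.isOpen_re_gt _
  have hLd : DifferentiableOn ℂ FL {s : ℂ | 0 < s.re} := hF.mul (by fun_prop)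
  have hRd : DifferentiableOn ℂ FR {s : ℂ | 0 < s.re} := by
    intro s hs
    have hs' : 0 < s.re := hs
    have h2s : 2 * s + 1 ≠ 1 := by
      intro h; apply hne0 s hs'; linear_combination h / 2
    have hζ : DifferentiableAt ℂ (fun s ↦ riemannZeta (2 * s + 1)) s :=
      (differentiableAt_riemannZeta h2s).comp s (by fun_prop)
    have hA : DifferentiableAt ℂ (fun s ↦ (s - 1 / 2) * riemannZeta (2 * s + 1)) s :=
      DifferentiableAt.mul (by fun_prop) hζ
    have hB : DifferentiableAt ℂ (fun s ↦ riemannZeta₁ (s + 1 / 2)) s := by fun_prop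
    exact ((hA.const_mul _).add (hB.const_mul _)).differentiableWithinAt
  have hLR : EqOn FL FR {s : ℂ | 0 < s.re} := by
    have h3 : ((3 : ℝ) : ℂ) ∈ {s : ℂ | 0 < s.re} := by simp
    have hev : FL =ᶠ[𝓝 ((3 : ℝ) : ℂ)] FR := by
      filter_upwards [(Landau.isOpen_re_gt 2).mem_nhds
        (show ((3 : ℝ) : ℂ) ∈ {s : ℂ | 2 < s.re} by simp; norm_num)] with s hs
      have hs' : 2 < s.re := hs
      have hζ₁ := hζ₁ne s hs'
      have hs0 : s ≠ 0 := hne0 s (by linarith)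
      simp only [hL, hR]
      rw [← hagree hs, hΦdef]
      beta_reduce
      set z := riemannZeta₁ (s + 1 / 2) with hz
      set y := riemannZeta (2 * s + 1) with hy
      field_simp
    exact (hLd.analyticOnNhd hV).eqOn_of_preconnected_of_eventuallyEq (hRd.analyticOnNhd hV)
      (convex_halfSpace_re_gt _).isPreconnected h3 hev
  -- so `ζ₁(u + 1/2) ≠ 0` for `Re u > 0`
  have hzero : ∀ s : ℂ, 0 < s.re → riemannZeta₁ (s + 1 / 2) ≠ 0 := by
    intro s hs h0
    have h2 := hLR hs
    simp only [hL, hR, h0, mul_zero, add_zero] at h2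
    have hs1 : s + 1 / 2 ≠ 1 := ne_one_of_riemannZeta₁_eq_zero h0
    have hs2 : s - 1 / 2 ≠ 0 := by
      intro h; apply hs1; linear_combination h
    have hζ2 : riemannZeta (2 * s + 1) ≠ 0 := riemannZeta_ne_zero_of_one_lt_re (by simp; linarith)
    exact mul_ne_zero (ofReal_ne_zero.mpr hε) (mul_ne_zero hs2 hζ2) h2.symm
  -- i.e. no zeros of `ζ` with `1/2 < Re w < 1`: the Riemann hypothesis
  have hq : QuasiRiemannHypothesis (1 / 2) := by
    intro w hw h1 h2
    have hw1 : w ≠ 1 := by intro h; rw [h, one_re] at h2; linarith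
    have h0 : riemannZeta₁ w = 0 := (riemannZeta₁_eq_zero_iff hw1).2 hw
    have := hzero (w - 1 / 2) (by simp; linarith)
    rw [sub_add_cancel] at this
    exact this h0
  exact (Summit.RiemannHypothesis_iff).2
    ((show QuasiRiemannHypothesis (1 / 2) ↔ _root_.RiemannHypothesis from
      quasiRiemannHypothesis_one_half_iff_holds).1 hq)

/-- **`L_{1/2}` bounded above on a half-line ⟹ RH** (the case `ε = -1`): in particular eventual
non-positivity `L_{1/2}(x) ≤ 0` (Mossinghoff–Trudgian 2012, Problem 4.3) implies the Riemann
hypothesis. [cite: MossinghoffTrudgian2012, Theorem 2.4 and Problem 4.3] -/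
theorem riemannHypothesis_of_liouvilleSqrtSum_le {c X₀ : ℝ}
    (h : ∀ x : ℝ, X₀ < x → liouvilleSqrtSum x ≤ c) : Summit.RiemannHypothesis :=
  riemannHypothesis_of_liouvilleSqrtSum_onesided (ε := -1) (c := c) (X₁ := X₀) (by norm_num)
    fun x hx ↦ by have := h x hx; linarith

/-- **The Mossinghoff–Trudgian `α = 1/2` conjecture** (Problem 4.3: "Determine if
`L_{1/2}(x) ≤ 0` for all `x ≥ 17`"; verified there for `17 ≤ x ≤ 10¹²`; unlike Pólya's and Turán's
conjectures it is not in conflict with the linear independence heuristic). An open conjecture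
recorded as a statement, not asserted. [cite: MossinghoffTrudgian2012, Problem 4.3] -/
@[conjecture] def MossinghoffTrudgianHalfConjecture : Prop :=
  ∀ x : ℝ, 17 ≤ x → liouvilleSqrtSum x ≤ 0

/-- **Mossinghoff–Trudgian's Problem 4.3 implies the Riemann hypothesis.**
[cite: MossinghoffTrudgian2012, Theorem 2.4 and Problem 4.3] -/
theorem riemannHypothesis_of_mossinghoffTrudgianHalf (h : MossinghoffTrudgianHalfConjecture) :
    Summit.RiemannHypothesis :=
  riemannHypothesis_of_liouvilleSqrtSum_le (c := 0) (X₀ := 17) fun x hx ↦ h x hx.le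

end Summit.RiemannHypothesis.RiemannHypothesis.Theorems
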